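import Summits.BirchSwinnertonDyer.BirchSwinnertonDyer.Theorems.BiquadraticEisensteinDescentHeegnerTwistCouplingInSupplyQuarticMinusTripleDescent
import HarnessLib

set_option linter.dupNamespace false -- `Summit.BirchSwinnertonDyer.BirchSwinnertonDyer.Theorems.…` (summit = sub)
set_option autoImplicit false

/-!
# Crux `HeegnerTwistCouplingInSupply` (stmt-BirchSwinnertonDyer-21381) — the QUARTIC `j = 1728` corner `W_p⁻ : y² = x³ − p·x`,
# TRIPLE TWIST, II: `S(0, 4s²q²ℓ²p) = {1, p}` (the `φ̂`-side)

Route `BiquadraticEisensteinDescent` (cell `pub/bsd-wall`, width seat `bsd-wall-cm-bed-w4` g14; `--supports` 21381, helper). Companion of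
`…QuarticMinusTripleDescent` (`S(0, −s²q²ℓ²p) = {1, −p}`): the other Selmer set of the twist `W_p⁻^{(−sqℓ)} : y² = x³ − s²q²ℓ²p·x`,
`p ≡ 7`, `s ≡ 1`, `q ≡ 3`, `ℓ ≡ 5 (mod 8)`, `(q/p) = −1` (so `(p/q) = +1`), `(p/s) = (p/ℓ) = −1` — Silverman's `S^{(φ)}(E/ℚ)`, the descent on
the divisors of `b′ = a² − 4b = 4s²q²ℓ²p`: ★ `mem_selmer_pos_iff_triple`, **`S(0, 4s²q²ℓ²p) = {1, p}`**. Again LEGENDRE-ONLY.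

Kills: `d < 0` at `∞`; every positive class divisible by `s`, `ℓ` or `q` at that prime by the generic kill of part I
(`not_mem_selmer_of_prime_dvd`: `b′ = t²·b₀` with `−b₀ = −4□·p` a non-residue — `(−p/s) = (p/s) = −1`, `(−p/ℓ) = (p/ℓ) = −1`,
`(−p/q) = −(p/q) = −1`); of the remaining `1, 2, p, 2p`: `2` and `2p` die at `q` (`2` a non-residue mod `q ≡ 3 (mod 8)`, second coefficient
`q²·(2□p)` resp. `q²·(2□)` with a non-residue cofactor: `…QuarticTwistLocal.not_isSoluble_padic_of_sq_mul`). No `2`-adic analysis on this side.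
HONEST FRAMING: a typed sub-corner on one CM family (measure zero in «all CM `W`»); the crux (residual C⁺) is untouched; BSD is not proved by
any of this. THEOREMS ONLY. Supports stmt-BirchSwinnertonDyer-21381.
-/

noncomputable section

open scoped Classical

namespace Summit.BirchSwinnertonDyer.BirchSwinnertonDyer.Theorems.BiquadraticEisensteinDescentHeegnerTwistCouplingInSupplyQuarticMinusTripleDescentDual

open Literature.NumberTheory.EllipticCurves Literature.NumberTheory.EllipticCurves.XCubeAddPX
  Summit.BirchSwinnertonDyer.BirchSwinnertonDyer.Theorems.BiquadraticEisensteinDescentHeegnerTwistCouplingInSupplyQuarticTwistLocal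
  Summit.BirchSwinnertonDyer.BirchSwinnertonDyer.Theorems.BiquadraticEisensteinDescentHeegnerTwistCouplingInSupplyQuarticTwistDescent
  Summit.BirchSwinnertonDyer.BirchSwinnertonDyer.Theorems.BiquadraticEisensteinDescentHeegnerTwistCouplingInSupplyQuarticTwistDescentDual
  Summit.BirchSwinnertonDyer.BirchSwinnertonDyer.Theorems.BiquadraticEisensteinDescentHeegnerTwistCouplingInSupplyQuarticMinusTripleDescent

variable {p q s l : ℕ} [hp : Fact p.Prime] [hq : Fact q.Prime] [hs : Fact s.Prime] [hl : Fact l.Prime]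

/-! ## §1 The non-residues `−b₀` of the three strips and the cofactors at `q` -/

omit hp hq hs hl in
/-- In `𝔽_t` (`t` prime): a non-square times a non-zero square is a non-square, product form with three square factors
`a · (x·x) · (y·y) · (z·z)`. [folklore] -/
theorem not_isSquare_mul_sq_sq_sq {t : ℕ} [Fact t.Prime] {a x y z : ZMod t} (ha : ¬ IsSquare a) (hx : x ≠ 0) (hy : y ≠ 0)
    (hz : z ≠ 0) : ¬ IsSquare (a * (x * x) * (y * y) * (z * z)) := by
  rw [show a * (x * x) * (y * y) * (z * z) = a * ((x * y * z) * (x * y * z)) by ring]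
  have h0 : x * y * z ≠ 0 := mul_ne_zero (mul_ne_zero hx hy) hz
  exact not_isSquare_mul_of_isSquare ha ⟨_, rfl⟩ (mul_ne_zero h0 h0)

omit hp hq hl in
/-- Strip at `s ≡ 1 (mod 4)`: `−b₀ = −4q²ℓ²p` is a non-residue mod `s` when `(p/s) = −1`, `s ∤ 2qℓ` (`−1` is a square mod `s`). [folklore] -/
theorem not_isSquare_strip_s_dual (hs4 : s % 4 = 1) (hps : ¬ IsSquare ((p : ℤ) : ZMod s)) (h2 : ((2 : ℤ) : ZMod s) ≠ 0)
    (hq0 : ((q : ℤ) : ZMod s) ≠ 0) (hl0 : ((l : ℤ) : ZMod s) ≠ 0) :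
    ¬ IsSquare (((-(4 * q ^ 2 * l ^ 2 * p) : ℤ)) : ZMod s) := by
  obtain ⟨i, hi⟩ := (ZMod.exists_sq_eq_neg_one_iff (p := s)).mpr (by omega)
  have hi0 : i ≠ 0 := by rintro rfl; simp at hi
  have e : (((-(4 * q ^ 2 * l ^ 2 * p) : ℤ)) : ZMod s) =
      ((p : ℤ) : ZMod s) * ((i * ((2 : ℤ) : ZMod s)) * (i * ((2 : ℤ) : ZMod s))) * ((((q : ℤ) : ZMod s)) * ((q : ℤ) : ZMod s)) *
        ((((l : ℤ) : ZMod s)) * ((l : ℤ) : ZMod s)) := by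
    push_cast
    linear_combination (4 * (q : ZMod s) ^ 2 * (l : ZMod s) ^ 2 * (p : ZMod s)) * hi
  rw [e]
  exact not_isSquare_mul_sq_sq_sq hps (mul_ne_zero hi0 h2) hq0 hl0

omit hp hq hs in
/-- Strip at `ℓ ≡ 1 (mod 4)`: `−b₀ = −4s²q²p` is a non-residue mod `ℓ` when `(p/ℓ) = −1`, `ℓ ∤ 2sq`. [folklore] -/
theorem not_isSquare_strip_l_dual (hl4 : l % 4 = 1) (hpl : ¬ IsSquare ((p : ℤ) : ZMod l)) (h2 : ((2 : ℤ) : ZMod l) ≠ 0)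
    (hs0 : ((s : ℤ) : ZMod l) ≠ 0) (hq0 : ((q : ℤ) : ZMod l) ≠ 0) :
    ¬ IsSquare (((-(4 * s ^ 2 * q ^ 2 * p) : ℤ)) : ZMod l) := by
  obtain ⟨i, hi⟩ := (ZMod.exists_sq_eq_neg_one_iff (p := l)).mpr (by omega)
  have hi0 : i ≠ 0 := by rintro rfl; simp at hi
  have e : (((-(4 * s ^ 2 * q ^ 2 * p) : ℤ)) : ZMod l) =
      ((p : ℤ) : ZMod l) * ((i * ((2 : ℤ) : ZMod l)) * (i * ((2 : ℤ) : ZMod l))) * ((((s : ℤ) : ZMod l)) * ((s : ℤ) : ZMod l)) *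
        ((((q : ℤ) : ZMod l)) * ((q : ℤ) : ZMod l)) := by
    push_cast
    linear_combination (4 * (s : ZMod l) ^ 2 * (q : ZMod l) ^ 2 * (p : ZMod l)) * hi
  rw [e]
  exact not_isSquare_mul_sq_sq_sq hpl (mul_ne_zero hi0 h2) hs0 hq0

omit hp hs hl in
/-- Strip at `q ≡ 3 (mod 4)`: `−b₀ = −4s²ℓ²p` is a non-residue mod `q` when `(p/q) = +1` (`−1` a non-residue), `q ∤ 2sℓp`. [folklore] -/
theorem not_isSquare_strip_q_dual (hq4 : q % 4 = 3) (hpq : IsSquare ((p : ℤ) : ZMod q)) (hp0 : ((p : ℤ) : ZMod q) ≠ 0)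
    (h2 : ((2 : ℤ) : ZMod q) ≠ 0) (hs0 : ((s : ℤ) : ZMod q) ≠ 0) (hl0 : ((l : ℤ) : ZMod q) ≠ 0) :
    ¬ IsSquare (((-(4 * s ^ 2 * l ^ 2 * p) : ℤ)) : ZMod q) := by
  obtain ⟨r, hr⟩ := hpq
  have hr0 : r ≠ 0 := by rintro rfl; exact hp0 (by rw [hr, mul_zero])
  have hr' : (p : ZMod q) = r * r := by exact_mod_cast hr
  have hm1 : ¬ IsSquare (((-1 : ℤ)) : ZMod q) := not_isSquare_neg_one (p := q) hq4
  have e : (((-(4 * s ^ 2 * l ^ 2 * p) : ℤ)) : ZMod q) =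
      (((-1 : ℤ)) : ZMod q) * ((r * ((2 : ℤ) : ZMod q)) * (r * ((2 : ℤ) : ZMod q))) * ((((s : ℤ) : ZMod q)) * ((s : ℤ) : ZMod q)) *
        ((((l : ℤ) : ZMod q)) * ((l : ℤ) : ZMod q)) := by
    push_cast
    linear_combination (-(4 : ZMod q) * (s : ZMod q) ^ 2 * (l : ZMod q) ^ 2) * hr'
  rw [e]
  exact not_isSquare_mul_sq_sq_sq hm1 (mul_ne_zero hr0 h2) hs0 hl0

omit hp hs hl in
/-- The cofactors at `q` for the classes `2` and `2p`: `2`, `2p`, `2s²ℓ²p`, `2s²ℓ²` are non-residues mod `q ≡ 3 (mod 8)` (`(2/q) = −1`,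
`(p/q) = +1`). [folklore] -/
theorem nonresidues_mod_q_dual (hq8 : q % 8 = 3) (hpq : IsSquare ((p : ℤ) : ZMod q)) (hp0 : ((p : ℤ) : ZMod q) ≠ 0)
    (hs0 : ((s : ℤ) : ZMod q) ≠ 0) (hl0 : ((l : ℤ) : ZMod q) ≠ 0) :
    ¬ IsSquare (((2 : ℤ)) : ZMod q) ∧ ¬ IsSquare (((2 * p : ℤ)) : ZMod q) ∧
      ¬ IsSquare (((2 * s ^ 2 * l ^ 2 * p : ℤ)) : ZMod q) ∧ ¬ IsSquare (((2 * s ^ 2 * l ^ 2 : ℤ)) : ZMod q) := by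
  have h2 := not_isSquare_two_mod_q (q := q) hq8
  obtain ⟨r, hr⟩ := hpq
  have hr0 : r ≠ 0 := by rintro rfl; exact hp0 (by rw [hr, mul_zero])
  have hr' : (p : ZMod q) = r * r := by exact_mod_cast hr
  have hsl0 : ((s : ℤ) : ZMod q) * ((l : ℤ) : ZMod q) ≠ 0 := mul_ne_zero hs0 hl0
  refine ⟨h2, ?_, ?_, ?_⟩
  · rw [show (((2 * p : ℤ)) : ZMod q) = (((2 : ℤ)) : ZMod q) * (r * r) by push_cast; rw [hr']]
    exact not_isSquare_mul_of_isSquare h2 ⟨_, rfl⟩ (mul_ne_zero hr0 hr0)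
  · rw [show (((2 * s ^ 2 * l ^ 2 * p : ℤ)) : ZMod q) = (((2 : ℤ)) : ZMod q) * (r * r) * (((s : ℤ) : ZMod q) * ((s : ℤ) : ZMod q)) *
        (((l : ℤ) : ZMod q) * ((l : ℤ) : ZMod q)) by push_cast; rw [hr']; ring]
    exact not_isSquare_mul_sq_sq_sq h2 hr0 hs0 hl0
  · rw [show (((2 * s ^ 2 * l ^ 2 : ℤ)) : ZMod q) = (((2 : ℤ)) : ZMod q) *
        ((((s : ℤ) : ZMod q) * ((l : ℤ) : ZMod q)) * (((s : ℤ) : ZMod q) * ((l : ℤ) : ZMod q))) by push_cast; ring]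
    exact not_isSquare_mul_of_isSquare h2 ⟨_, rfl⟩ (mul_ne_zero hsl0 hsl0)

/-! ## §2 The side `S(0, 4s²q²ℓ²p) = {1, p}` -/

omit hs hq hl in
/-- The positive squarefree divisors of `4s²q²ℓ²p` prime to `s`, `q`, `ℓ`: `1, 2, p, 2p`. [folklore] -/
theorem natAbs_eq_of_squarefree_dvd_triple_dual {d : ℤ} (hsq : Squarefree d) (hdvd : d ∣ (4 * s ^ 2 * q ^ 2 * l ^ 2 * p : ℤ))
    (hsP : s.Prime) (hqP : q.Prime) (hlP : l.Prime) (hsd : ¬ (s : ℤ) ∣ d) (hqd : ¬ (q : ℤ) ∣ d) (hld : ¬ (l : ℤ) ∣ d) :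
    d.natAbs = 1 ∨ d.natAbs = 2 ∨ d.natAbs = p ∨ d.natAbs = 2 * p := by
  set m := d.natAbs with hm_def
  have hmsq : Squarefree m := Int.squarefree_natAbs.mpr hsq
  have hsm : ¬ s ∣ m := fun h => hsd (Int.natCast_dvd.mpr h)
  have hqm : ¬ q ∣ m := fun h => hqd (Int.natCast_dvd.mpr h)
  have hlm : ¬ l ∣ m := fun h => hld (Int.natCast_dvd.mpr h)
  have hm1 : m ∣ 4 * s ^ 2 * q ^ 2 * l ^ 2 * p := by
    have h1 := Int.natAbs_dvd_natAbs.mpr hdvd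
    have h2 : (4 * s ^ 2 * q ^ 2 * l ^ 2 * p : ℤ).natAbs = 4 * s ^ 2 * q ^ 2 * l ^ 2 * p := by
      rw [show (4 * s ^ 2 * q ^ 2 * l ^ 2 * p : ℤ) = ((4 * s ^ 2 * q ^ 2 * l ^ 2 * p : ℕ) : ℤ) by push_cast; ring, Int.natAbs_natCast]
    rwa [h2] at h1
  have hm2 : m ∣ (s * (q * (l * (2 * p)))) ^ 2 := dvd_trans hm1 ⟨p, by ring⟩
  have hm3 : m ∣ s * (q * (l * (2 * p))) := (hmsq.dvd_pow_iff_dvd two_ne_zero).mp hm2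
  obtain ⟨a, b, ha, hb, hm⟩ := exists_dvd_and_dvd_of_dvd_mul hm3
  obtain ⟨b₁, b₂, hb₁, hb₂, rfl⟩ := exists_dvd_and_dvd_of_dvd_mul hb
  obtain ⟨c₁, c₂, hc₁, hc₂, rfl⟩ := exists_dvd_and_dvd_of_dvd_mul hb₂
  obtain ⟨e₁, e₂, he₁, he₂, rfl⟩ := exists_dvd_and_dvd_of_dvd_mul hc₂
  have ha1 : a = 1 := by
    rcases (Nat.dvd_prime hsP).mp ha with h | h
    · exact h
    · exact absurd ⟨b₁ * (c₁ * (e₁ * e₂)), by rw [hm, h]⟩ hsm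
  have hb1 : b₁ = 1 := by
    rcases (Nat.dvd_prime hqP).mp hb₁ with h | h
    · exact h
    · exact absurd ⟨a * (c₁ * (e₁ * e₂)), by rw [hm, h]; ring⟩ hqm
  have hc1 : c₁ = 1 := by
    rcases (Nat.dvd_prime hlP).mp hc₁ with h | h
    · exact h
    · exact absurd ⟨a * (b₁ * (e₁ * e₂)), by rw [hm, h]; ring⟩ hlm
  rw [hm, ha1, hb1, hc1, one_mul, one_mul, one_mul]
  rcases (Nat.dvd_prime Nat.prime_two).mp he₁ with h1 | h1 <;> rcases (Nat.dvd_prime hp.out).mp he₂ with h2 | h2 <;>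
    simp [h1, h2]

/-- ★ **`S(0, 4s²q²ℓ²p) = {1, p}`** for primes `p ≡ 7 (mod 8)`, `s ≡ 1`, `q ≡ 3`, `ℓ ≡ 5 (mod 8)` with `(q/p) = −1`, `(p/s) = −1`, `(p/ℓ) = −1`:
descent on the divisors of `b′ = 4s²q²ℓ²p` (Silverman's `S^{(φ)}(E/ℚ)` for `E : y² = x³ − s²q²ℓ²p·x`). Legendre-only.
[cite: SilvermanAEC2009, Prop. X.4.9 and Prop. X.6.1] -/
theorem mem_selmer_pos_iff_triple (hp8 : p % 8 = 7) (hs8 : s % 8 = 1) (hq8 : q % 8 = 3) (hl8 : l % 8 = 5)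
    (hnq : ¬ IsSquare ((q : ℤ) : ZMod p)) (hps : ¬ IsSquare ((p : ℤ) : ZMod s)) (hpl : ¬ IsSquare ((p : ℤ) : ZMod l))
    (d : ℤ) :
    d ∈ twoIsogenySelmerGroup 0 (4 * s ^ 2 * q ^ 2 * l ^ 2 * p : ℤ) ↔ d = 1 ∨ d = (p : ℤ) := by
  have hP := hp.out
  have hQ := hq.out
  have hS := hs.out
  have hL := hl.out
  have hqp : q ≠ p := by rintro rfl; omega
  have hsp : s ≠ p := by rintro rfl; omega
  have hlp : l ≠ p := by rintro rfl; omega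
  have hsq' : s ≠ q := by rintro rfl; omega
  have hsl : s ≠ l := by rintro rfl; omega
  have hql : q ≠ l := by rintro rfl; omega
  have hp0 : (p : ℤ) ≠ 0 := by exact_mod_cast hP.ne_zero
  have hq0 : (q : ℤ) ≠ 0 := by exact_mod_cast hQ.ne_zero
  have hs0 : (s : ℤ) ≠ 0 := by exact_mod_cast hS.ne_zero
  have hl0 : (l : ℤ) ≠ 0 := by exact_mod_cast hL.ne_zero
  have hbpos : (0 : ℤ) < 4 * s ^ 2 * q ^ 2 * l ^ 2 * p := by positivity
  have hb : (4 * s ^ 2 * q ^ 2 * l ^ 2 * p : ℤ) ≠ 0 := hbpos.ne'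
  -- casting non-vanishing of the primes modulo each other
  have cast_ne : ∀ {a t : ℕ}, t.Prime → a.Prime → t ≠ a → ((a : ℤ) : ZMod t) ≠ 0 := fun {a t} htP haP hta h0 =>
    hta ((Nat.prime_dvd_prime_iff_eq htP haP).mp (by exact_mod_cast (ZMod.intCast_zmod_eq_zero_iff_dvd a t).mp h0))
  have h2s : ((2 : ℤ) : ZMod s) ≠ 0 := by exact_mod_cast cast_ne (a := 2) hS Nat.prime_two (by rintro rfl; omega)
  have h2l : ((2 : ℤ) : ZMod l) ≠ 0 := by exact_mod_cast cast_ne (a := 2) hL Nat.prime_two (by rintro rfl; omega)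
  have h2q : ((2 : ℤ) : ZMod q) ≠ 0 := by exact_mod_cast cast_ne (a := 2) hQ Nat.prime_two (by rintro rfl; omega)
  have hpq : IsSquare ((p : ℤ) : ZMod q) := isSquare_p_mod_q (p := p) (q := q) (by omega) (by omega) hnq
  have strip_s := not_isSquare_strip_s_dual (p := p) (q := q) (l := l) (by omega) hps h2s (cast_ne hS hQ hsq') (cast_ne hS hL hsl)
  have strip_l := not_isSquare_strip_l_dual (p := p) (q := q) (s := s) (by omega) hpl h2l (cast_ne hL hS (Ne.symm hsl))
    (cast_ne hL hQ (Ne.symm hql))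
  have strip_q := not_isSquare_strip_q_dual (s := s) (l := l) (by omega) hpq (cast_ne hQ hP hqp) h2q
    (cast_ne hQ hS (Ne.symm hsq')) (cast_ne hQ hL hql)
  obtain ⟨hn2, hn2p, hn2slp, hn2sl⟩ := nonresidues_mod_q_dual (s := s) (l := l) hq8 hpq (cast_ne hQ hP hqp)
    (cast_ne hQ hS (Ne.symm hsq')) (cast_ne hQ hL hql)
  haveI : Fact (Nat.Prime 2) := ⟨Nat.prime_two⟩
  constructor
  · intro hd
    have hsqf := squarefree_of_mem_twoIsogenySelmerGroup hd
    have hd0 : d ≠ 0 := hsqf.ne_zero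
    have hdvd : d ∣ (4 * s ^ 2 * q ^ 2 * l ^ 2 * p : ℤ) := dvd_of_mem_twoIsogenySelmerGroup hd
    have key : ∀ d' : ℤ, d * d' = (4 * s ^ 2 * q ^ 2 * l ^ 2 * p : ℤ) → (twoIsogenyQuartic 0 d d').IsLocallySoluble :=
      fun d' hdd => isLocallySoluble_of_mem hd0 hdd hd
    rcases lt_or_gt_of_ne hd0 with hneg | hpos
    · exfalso
      obtain ⟨d', hd'⟩ := hdvd
      have hd'neg : d' < 0 := by
        rcases pos_and_pos_or_neg_and_neg_of_mul_pos (show 0 < d * d' by rw [← hd']; exact hbpos) with ⟨h1, -⟩ | ⟨-, h2⟩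
        · exact absurd h1 (not_lt.mpr hneg.le)
        · exact h2
      exact not_isSoluble_real_twoIsogenyQuartic_of_neg hneg hd'neg le_rfl (key d' hd'.symm).1
    -- classes divisible by `s`, `ℓ`, `q` die at that prime
    have hsd : ¬ (s : ℤ) ∣ d := fun h =>
      not_mem_selmer_of_prime_dvd (t := s) (b₀ := (4 * q ^ 2 * l ^ 2 * p : ℤ)) (by ring) strip_s h hd
    have hld : ¬ (l : ℤ) ∣ d := fun h =>
      not_mem_selmer_of_prime_dvd (t := l) (b₀ := (4 * s ^ 2 * q ^ 2 * p : ℤ)) (by ring) strip_l h hd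
    have hqd : ¬ (q : ℤ) ∣ d := fun h =>
      not_mem_selmer_of_prime_dvd (t := q) (b₀ := (4 * s ^ 2 * l ^ 2 * p : ℤ)) (by ring) strip_q h hd
    have hdabs : d = (d.natAbs : ℤ) := (Int.natAbs_of_nonneg hpos.le).symm ▸ rfl
    rcases natAbs_eq_of_squarefree_dvd_triple_dual (p := p) hsqf hdvd hS hQ hL hsd hqd hld with h | h | h | h <;>
      rw [h] at hdabs <;> push_cast at hdabs <;> subst hdabs
    · exact Or.inl rfl
    · -- d = 2 : dies at q
      refine absurd ((key (2 * s ^ 2 * q ^ 2 * l ^ 2 * p) (by ring)).2 q) ?_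
      exact not_isSoluble_padic_of_sq_mul (ℓ := q) (c := 2) (c' := 2 * s ^ 2 * q ^ 2 * l ^ 2 * p) (c'' := 2 * s ^ 2 * l ^ 2 * p)
        (by ring) hn2 hn2slp
    · exact Or.inr rfl
    · -- d = 2p : dies at q
      refine absurd ((key (2 * s ^ 2 * q ^ 2 * l ^ 2) (by ring)).2 q) ?_
      exact not_isSoluble_padic_of_sq_mul (ℓ := q) (c := 2 * (p : ℤ)) (c' := 2 * s ^ 2 * q ^ 2 * l ^ 2) (c'' := 2 * s ^ 2 * l ^ 2)
        (by ring) hn2p hn2sl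
  · rintro (rfl | rfl)
    · exact one_mem_twoIsogenySelmerGroup 0 hb
    · refine mem_twoIsogenySelmerGroup_of_isSquare hb ?_ ⟨4 * s ^ 2 * q ^ 2 * l ^ 2, by ring⟩ ⟨2 * s * q * l, ?_⟩
      · exact Int.squarefree_natAbs.mp (by rw [Int.natAbs_natCast]; exact hP.prime.squarefree)
      · rw [show (4 * s ^ 2 * q ^ 2 * l ^ 2 * p : ℤ) = (p : ℤ) * (4 * s ^ 2 * q ^ 2 * l ^ 2) by ring, Int.mul_ediv_cancel_left _ hp0]
        ring

end Summit.BirchSwinnertonDyer.BirchSwinnertonDyer.Theorems.BiquadraticEisensteinDescentHeegnerTwistCouplingInSupplyQuarticMinusTripleDescentDual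

end
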